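import Literature.NumberTheory.Automorphic.Liu2021.Def411AsPrinted
import Summits.HodgeConjecture.CorCM.D2Bridge.NotHJMultiplicityFree
import Summits.HodgeConjecture.CorCM.D2Bridge.NotHJTwoSocket
import HarnessLib

/-!
# ¬hJ lane, M2a-E — a multiplicity-free `ℂ[G]`-decomposition FROM THE END-ROW CURRENCY (delrec-p5 g6, M2 co-pen; DESK DRAFT)

HC_CM is NOT proved; nothing in this file asserts `hJ`, `hJ₀` or their negations.  Generic representation theory:
`Mathlib` + the tree's reading `IsIrreducibleOrZero` of [Liu2021, Def. 4.11] + ✔ M1 (`D2Bridge/NotHJMultiplicityFree.lean`, bridge only)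
+ ✔ M1′ (`D2Bridge/NotHJTwoSocket.lean`, `multiplicityFree_of_iSupIndep_simple`, for the ATOM form).

INPUT (= the END-ELECT's rows `h413` ∕ `h411` ∕ (`hD3`,`hμsep`) in the currency in which the tree already consumes them,
cf. `UniformOmega.rank_intertwiningMap_rhoAt_rest_le_one_of_prop413AsPrinted` and nothj-p4's HEAD skeleton v0 §3 binders
`σ413 ∕ Φ413 ∕ hΦ413 ∕ h411W ∕ hsepW`): a `ℂ[G]`-module `H`, a `ℂ`-LINEAR equivalence `Φ : H ≃ₗ[ℂ] ⨁ t, W t` intertwining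
`Representation.ofModule' H` with representations `σ t` ([Liu2021, Prop. 4.13] AS PRINTED: «isomorphism … of `ℂ[G]`-modules»),
each `σ t` irreducible-or-zero ([Liu2021, Def. 4.11], `IsIrreducibleOrZero`), and pairwise non-isomorphy of the non-zero summands
([Liu2021, Thm. 4.18 (2)], [Liu2021, Lem. D.1 (3)]).

OUTPUT (`exists_multiplicityFree_decomposition`): `ℂ[G]`-SUBMODULES `C t ≤ H`, one for each index `t` with `W t ≠ 0`, whose
`ℂ`-carrier is `Φ⁻¹(ω_t)`, forming an INTERNAL DIRECT SUM of `H`, each a SIMPLE `ℂ[G]`-module, PAIRWISE NON-ISOMORPHIC — i.e. the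
hypotheses `hint ∕ hs ∕ hni` of milestone M1 (`NotHJ.map_le_self_of_multiplicityFree` &c.) at `R := ℂ[G]`; whence also
`IsSemisimpleModule ℂ[G] H`, the ATOM form `exists_multiplicityFree_decomposition_atom` (simplicity as `IsAtom (C t)` in the lattice of
`ℂ[G]`-submodules — the form that elaborates at the model tower, where `AddCommGroup ↥S` does not synthesize), and the HEAD-A consumer
interface VERBATIM (nothj-p4 `false_of_componentAlbanese_iota1_of_multOne_of_nontrivial` rows (i)):
`multOne_of_equivariant_directSum : … → IsSemisimpleModule ℂ[G] H ∧ ∀ S S', IsAtom S → IsAtom S' → Nonempty (S ≃ₗ[ℂ[G]] S') → S = S'`.  No model object, no `𝔇.Prop413` (the MODEL-indexed sentence, which the END rows do not supply).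
-/

noncomputable section

open scoped DirectSum

namespace Summit.HodgeConjecture.CorCM.D2Bridge.NotHJ

open Literature.NumberTheory.Automorphic.Liu2021 (IsIrreducibleOrZero)

universe u

section Rep

variable {G : Type} [Group G] {H : Type u} [AddCommGroup H] [Module ℂ H]
  [Module (MonoidAlgebra ℂ G) H] [IsScalarTower ℂ (MonoidAlgebra ℂ G) H]
  {ι : Type} [DecidableEq ι] {W : ι → Type} [∀ t, AddCommGroup (W t)] [∀ t, Module ℂ (W t)]

/-- `Representation.ofModule' H g h = of g • h`. [folklore] -/
private theorem ofModule'_apply_eq (g : G) (h : H) :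
    Representation.ofModule' (k := ℂ) (G := G) H g h = MonoidAlgebra.of ℂ G g • h := by
  simp only [Representation.ofModule', MonoidAlgebra.lift_symm_apply, Algebra.lsmul_coe, MonoidAlgebra.of_apply]

/-- Membership in `Φ⁻¹(ω_t)`: the `ℂ`-subspace `(range ι_t).map Φ⁻¹` consists of the `Φ⁻¹(ι_t w)`. [folklore] -/
private theorem mem_map_range_lof_iff (Φ : H ≃ₗ[ℂ] ⨁ t, W t) (t : ι) (x : H) :
    x ∈ (LinearMap.range (DirectSum.lof ℂ ι W t)).map (Φ.symm : (⨁ t, W t) →ₗ[ℂ] H) ↔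
      ∃ w : W t, x = Φ.symm (DirectSum.lof ℂ ι W t w) := by
  constructor
  · rintro ⟨_, ⟨w, rfl⟩, rfl⟩
    exact ⟨w, rfl⟩
  · rintro ⟨w, rfl⟩
    exact ⟨_, ⟨w, rfl⟩, rfl⟩

/-- Reading back the `t`-th coordinate of `Φ⁻¹(ι_t w)`. [folklore] -/
private theorem apply_symm_lof_self (Φ : H ≃ₗ[ℂ] ⨁ t, W t) (t : ι) (w : W t) :
    Φ (Φ.symm (DirectSum.lof ℂ ι W t w)) t = w := by
  rw [LinearEquiv.apply_symm_apply, DirectSum.lof_apply]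

/-- **Equivariance on a summand.**  If `Φ` intertwines `ofModule' H` with the `σ t`, then `of g • Φ⁻¹(ι_t w) = Φ⁻¹(ι_t (σ_t(g) w))`.
[cite: Liu2021, Prop. 4.13] -/
private theorem of_smul_symm_lof (σ : ∀ t, Representation ℂ G (W t)) (Φ : H ≃ₗ[ℂ] ⨁ t, W t)
    (hΦ : ∀ (g : G) (x : H) (t : ι), Φ (Representation.ofModule' (k := ℂ) (G := G) H g x) t = σ t g (Φ x t))
    (g : G) (t : ι) (w : W t) :
    MonoidAlgebra.of ℂ G g • Φ.symm (DirectSum.lof ℂ ι W t w) = Φ.symm (DirectSum.lof ℂ ι W t (σ t g w)) := by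
  rw [← ofModule'_apply_eq, LinearEquiv.eq_symm_apply]
  refine DirectSum.ext (β := W) (fun s => ?_)
  rw [hΦ, LinearEquiv.apply_symm_apply]
  by_cases hst : s = t
  · subst hst
    rw [DirectSum.lof_apply, DirectSum.lof_apply]
  · rw [DirectSum.lof_eq_of, DirectSum.lof_eq_of, DirectSum.of_eq_of_ne _ _ _ hst, DirectSum.of_eq_of_ne _ _ _ hst, map_zero]

/-- **M2a-E.**  From a `ℂ`-linear `G`-equivariant decomposition `Φ : H ≃ ⨁ t, W t` of a `ℂ[G]`-module `H` ([Liu2021, Prop. 4.13] as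
printed) into irreducible-or-zero summands `σ t` ([Liu2021, Def. 4.11]) that are pairwise non-isomorphic when non-zero ([Liu2021,
Thm. 4.18 (2)] ∕ [Liu2021, Lem. D.1 (3)]): there are `ℂ[G]`-submodules `C t ≤ H`, one for each index with `W t ≠ 0`, with `ℂ`-carrier
`Φ⁻¹(ω_t)`, forming an internal direct sum of `H`, each SIMPLE over `ℂ[G]`, pairwise NON-ISOMORPHIC over `ℂ[G]`.
[cite: Liu2021, Prop. 4.13 (FJcycle.tex ll. 2113–2119), Def. 4.11 (ll. 2083–2097), Thm. 4.18 (2) (l. 2240), App. D Lem. D.1 (3)] -/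
theorem exists_multiplicityFree_decomposition (σ : ∀ t, Representation ℂ G (W t)) (Φ : H ≃ₗ[ℂ] ⨁ t, W t)
    (hΦ : ∀ (g : G) (x : H) (t : ι), Φ (Representation.ofModule' (k := ℂ) (G := G) H g x) t = σ t g (Φ x t))
    (h411 : ∀ t, IsIrreducibleOrZero (σ t))
    (hsep : ∀ s t : ι, Nontrivial (W s) →
      (∃ f : W s ≃ₗ[ℂ] W t, ∀ (g : G) (v : W s), f (σ s g v) = σ t g (f v)) → s = t) :
    ∃ C : {t : ι // Nontrivial (W t)} → Submodule (MonoidAlgebra ℂ G) H,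
      (∀ t, (C t).restrictScalars ℂ =
        (LinearMap.range (DirectSum.lof ℂ ι W t.1)).map (Φ.symm : (⨁ t, W t) →ₗ[ℂ] H)) ∧
      DirectSum.IsInternal C ∧
      (∀ t, IsSimpleModule (MonoidAlgebra ℂ G) (C t)) ∧
      (∀ s t, Nonempty (C s ≃ₗ[MonoidAlgebra ℂ G] C t) → s = t) := by
  classical
  -- the ℂ-carriers
  let S : ι → Submodule ℂ H := fun t =>
    (LinearMap.range (DirectSum.lof ℂ ι W t)).map (Φ.symm : (⨁ t, W t) →ₗ[ℂ] H)
  have hmemS : ∀ t x, x ∈ S t ↔ ∃ w : W t, x = Φ.symm (DirectSum.lof ℂ ι W t w) :=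
    fun t x => mem_map_range_lof_iff Φ t x
  -- the ℂ[G]-submodules
  let C : {t : ι // Nontrivial (W t)} → Submodule (MonoidAlgebra ℂ G) H := fun t =>
    { carrier := S t.1
      add_mem' := fun ha hb => (S t.1).add_mem ha hb
      zero_mem' := (S t.1).zero_mem
      smul_mem' := fun a x hx => by
        change x ∈ S t.1 at hx
        change a • x ∈ S t.1
        refine MonoidAlgebra.induction_on (p := fun a : MonoidAlgebra ℂ G => a • x ∈ S t.1) a
          (fun g => ?_) (fun b c hb hc => ?_) (fun r b hb => ?_)
        · obtain ⟨w, rfl⟩ := (hmemS t.1 x).mp hx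
          rw [of_smul_symm_lof σ Φ hΦ g t.1 w]
          exact (hmemS t.1 _).mpr ⟨σ t.1 g w, rfl⟩
        · rw [add_smul]
          exact (S t.1).add_mem hb hc
        · rw [smul_assoc]
          exact (S t.1).smul_mem r hb }
  have hCS : ∀ t, (C t).restrictScalars ℂ = S t.1 := fun t => SetLike.coe_injective rfl
  have hmemC : ∀ (t : {t : ι // Nontrivial (W t)}) (x : H), x ∈ C t ↔ ∃ w : W t.1, x = Φ.symm (DirectSum.lof ℂ ι W t.1 w) :=
    fun t x => hmemS t.1 x
  refine ⟨C, hCS, ?_, ?_, ?_⟩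
  · -- internal direct sum: transport the tautological decomposition of `⨁ W` along `Φ⁻¹`, drop the zero summands
    have hS : DirectSum.IsInternal S := isInternal_map_of_equiv W Φ
    rw [DirectSum.isInternal_submodule_iff_iSupIndep_and_iSup_eq_top] at hS
    obtain ⟨hind, hsup⟩ := hS
    have hS0 : ∀ t, ¬ Nontrivial (W t) → S t = ⊥ := by
      intro t ht
      haveI : Subsingleton (W t) := not_nontrivial_iff_subsingleton.mp ht
      rw [eq_bot_iff]
      intro x hx
      obtain ⟨w, rfl⟩ := (hmemS t x).mp hx
      rw [Subsingleton.elim w 0, map_zero, map_zero]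
      exact Submodule.zero_mem _
    have hindC : iSupIndep C := by
      intro i
      have hi := (hind.comp (Subtype.val_injective (p := fun t : ι => Nontrivial (W t)))) i
      rw [disjoint_iff] at hi ⊢
      refine (Submodule.restrictScalars_eq_bot_iff ℂ (MonoidAlgebra ℂ G) H).mp ?_
      rw [Submodule.restrictScalars_inf, Submodule.restrictScalars_iSup]
      simp_rw [Submodule.restrictScalars_iSup, hCS]
      exact hi
    have hsupC : ⨆ t, C t = ⊤ := by
      refine (Submodule.restrictScalars_eq_top_iff ℂ (MonoidAlgebra ℂ G) H).mp ?_
      rw [Submodule.restrictScalars_iSup]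
      simp_rw [hCS]
      rw [← hsup]
      apply le_antisymm
      · exact iSup_le fun t => le_iSup S t.1
      · refine iSup_le fun t => ?_
        by_cases ht : Nontrivial (W t)
        · exact le_iSup (fun s : {t : ι // Nontrivial (W t)} => S s.1) ⟨t, ht⟩
        · rw [hS0 t ht]
          exact bot_le
    exact DirectSum.isInternal_submodule_of_iSupIndep_of_iSup_eq_top hindC hsupC
  · -- simplicity from `IsIrreducibleOrZero (σ t)` and `W t ≠ 0`
    intro t
    haveI : Nontrivial (W t.1) := t.2
    rw [isSimpleModule_iff_isAtom]
    refine ⟨fun hbot => ?_, fun N hN => ?_⟩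
    · obtain ⟨w, hw⟩ := exists_ne (0 : W t.1)
      apply hw
      have hx : Φ.symm (DirectSum.lof ℂ ι W t.1 w) ∈ C t := (hmemC t _).mpr ⟨w, rfl⟩
      rw [hbot, Submodule.mem_bot, LinearEquiv.map_eq_zero_iff] at hx
      have := congrArg (fun v : ⨁ t, W t => v t.1) hx
      simpa only [DirectSum.lof_apply, DirectSum.zero_apply] using this
    · -- the subrepresentation `{w | Φ⁻¹(ι_t w) ∈ N}` of `σ t`
      let P : Subrepresentation (σ t.1) :=
        { toSubmodule := (N.restrictScalars ℂ).comap
            ((Φ.symm : (⨁ t, W t) →ₗ[ℂ] H) ∘ₗ DirectSum.lof ℂ ι W t.1)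
          apply_mem_toSubmodule := fun g w hw => by
            change Φ.symm (DirectSum.lof ℂ ι W t.1 (σ t.1 g w)) ∈ N
            rw [← of_smul_symm_lof σ Φ hΦ g t.1 w]
            exact N.smul_mem _ hw }
      have hPmem : ∀ w, w ∈ P ↔ Φ.symm (DirectSum.lof ℂ ι W t.1 w) ∈ N := fun w => Iff.rfl
      rcases h411 t.1 P with hP | hP
      · -- `P = ⊥` ⇒ `N = ⊥`
        rw [eq_bot_iff]
        intro x hx
        obtain ⟨w, rfl⟩ := (hmemC t x).mp (hN.le hx)
        have hwP : w ∈ P.toSubmodule := (hPmem w).mpr hx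
        have hPbot : P.toSubmodule = ⊥ := by
          rw [hP]
          rfl
        rw [hPbot, Submodule.mem_bot] at hwP
        rw [hwP, map_zero, map_zero]
        exact Submodule.zero_mem _
      · -- `P = ⊤` ⇒ `C t ≤ N`, contradicting `N < C t`
        exfalso
        apply hN.ne
        refine le_antisymm hN.le fun x hx => ?_
        obtain ⟨w, rfl⟩ := (hmemC t x).mp hx
        have hPtop : P.toSubmodule = ⊤ := by
          rw [hP]
          rfl
        have hwP : w ∈ P.toSubmodule := by
          rw [hPtop]
          exact Submodule.mem_top
        exact (hPmem w).mp hwP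
  · -- pairwise non-isomorphy from `hsep`: an `ℂ[G]`-iso `C s ≃ C t` transports to an equivariant `ℂ`-iso `W s ≃ W t`
    intro s t hst
    obtain ⟨f⟩ := hst
    haveI : Nontrivial (W s.1) := s.2
    have hmem_s : ∀ w, Φ.symm (DirectSum.lof ℂ ι W s.1 w) ∈ C s := fun w => (hmemC s _).mpr ⟨w, rfl⟩
    have hmem_t : ∀ w, Φ.symm (DirectSum.lof ℂ ι W t.1 w) ∈ C t := fun w => (hmemC t _).mpr ⟨w, rfl⟩
    -- reading a member of `C u` back as `Φ⁻¹(ι_u w)`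
    have hback_s : ∀ y : C s, Φ.symm (DirectSum.lof ℂ ι W s.1 (Φ (y : H) s.1)) = (y : H) := by
      intro y
      obtain ⟨w, hw⟩ := (hmemC s (y : H)).mp y.2
      rw [hw, apply_symm_lof_self]
    have hback_t : ∀ y : C t, Φ.symm (DirectSum.lof ℂ ι W t.1 (Φ (y : H) t.1)) = (y : H) := by
      intro y
      obtain ⟨w, hw⟩ := (hmemC t (y : H)).mp y.2
      rw [hw, apply_symm_lof_self]
    -- the ℂ-linear charts `W u → C u`
    let ψs : W s.1 →ₗ[ℂ] C s :=
      { toFun := fun w => ⟨Φ.symm (DirectSum.lof ℂ ι W s.1 w), hmem_s w⟩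
        map_add' := fun a b => Subtype.ext (by simp only [map_add, Submodule.coe_add])
        map_smul' := fun c a => Subtype.ext (by
          simp only [map_smul, RingHom.id_apply, Submodule.coe_smul_of_tower]) }
    let ψt : W t.1 →ₗ[ℂ] C t :=
      { toFun := fun w => ⟨Φ.symm (DirectSum.lof ℂ ι W t.1 w), hmem_t w⟩
        map_add' := fun a b => Subtype.ext (by simp only [map_add, Submodule.coe_add])
        map_smul' := fun c a => Subtype.ext (by
          simp only [map_smul, RingHom.id_apply, Submodule.coe_smul_of_tower]) }
    have hψs : ∀ w, ((ψs w : C s) : H) = Φ.symm (DirectSum.lof ℂ ι W s.1 w) := fun w => rfl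
    have hψt : ∀ w, ((ψt w : C t) : H) = Φ.symm (DirectSum.lof ℂ ι W t.1 w) := fun w => rfl
    have hfs : ∀ (c : ℂ) (y : C s), f (c • y) = c • f y := fun c y => f.toLinearMap.map_smul_of_tower c y
    have hfs' : ∀ (c : ℂ) (y : C t), f.symm (c • y) = c • f.symm y := fun c y =>
      f.symm.toLinearMap.map_smul_of_tower c y
    -- the transported maps
    let e : W s.1 →ₗ[ℂ] W t.1 :=
      { toFun := fun w => Φ ((f (ψs w) : C t) : H) t.1
        map_add' := fun a b => by
          simp only [map_add, Submodule.coe_add, DirectSum.add_apply]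
        map_smul' := fun c a => by
          simp only [map_smul, hfs, Submodule.coe_smul_of_tower, RingHom.id_apply, DirectSum.smul_apply] }
    let e' : W t.1 →ₗ[ℂ] W s.1 :=
      { toFun := fun w => Φ ((f.symm (ψt w) : C s) : H) s.1
        map_add' := fun a b => by
          simp only [map_add, Submodule.coe_add, DirectSum.add_apply]
        map_smul' := fun c a => by
          simp only [map_smul, hfs', Submodule.coe_smul_of_tower, RingHom.id_apply, DirectSum.smul_apply] }
    have he : ∀ w, e w = Φ ((f (ψs w) : C t) : H) t.1 := fun w => rfl
    have he' : ∀ w, e' w = Φ ((f.symm (ψt w) : C s) : H) s.1 := fun w => rfl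
    -- `ψt (e w) = f (ψs w)` and `ψs (e' w) = f.symm (ψt w)`
    have hψt_e : ∀ w, ψt (e w) = f (ψs w) := fun w => Subtype.ext (by rw [hψt, he, hback_t])
    have hψs_e' : ∀ w, ψs (e' w) = f.symm (ψt w) := fun w => Subtype.ext (by rw [hψs, he', hback_s])
    have h1 : ∀ w, e' (e w) = w := fun w => by
      rw [he', hψt_e, LinearEquiv.symm_apply_apply, hψs, apply_symm_lof_self]
    have h2 : ∀ w, e (e' w) = w := fun w => by
      rw [he, hψs_e', LinearEquiv.apply_symm_apply, hψt, apply_symm_lof_self]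
    have hbij : Function.Bijective e :=
      ⟨Function.LeftInverse.injective h1, Function.RightInverse.surjective h2⟩
    -- equivariance
    have hψs_G : ∀ (g : G) (w : W s.1), ψs (σ s.1 g w) = MonoidAlgebra.of ℂ G g • ψs w := fun g w =>
      Subtype.ext (by rw [hψs, Submodule.coe_smul, hψs, of_smul_symm_lof σ Φ hΦ g s.1 w])
    have heG : ∀ (g : G) (w : W s.1), e (σ s.1 g w) = σ t.1 g (e w) := fun g w => by
      rw [he, he, hψs_G, map_smul, Submodule.coe_smul, ← ofModule'_apply_eq, hΦ]
    refine Subtype.ext (hsep s.1 t.1 s.2 ⟨LinearEquiv.ofBijective e hbij, fun g v => ?_⟩)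
    rw [LinearEquiv.ofBijective_apply, LinearEquiv.ofBijective_apply, heG]

/-- **Corollary (HEAD-A's standing hypothesis).**  Under the same END-row hypotheses the `ℂ[G]`-module `H` is SEMISIMPLE
(a sum of simple submodules). [cite: Liu2021, Prop. 4.13 and Def. 4.11] -/
theorem isSemisimpleModule_of_equivariant_directSum (σ : ∀ t, Representation ℂ G (W t)) (Φ : H ≃ₗ[ℂ] ⨁ t, W t)
    (hΦ : ∀ (g : G) (x : H) (t : ι), Φ (Representation.ofModule' (k := ℂ) (G := G) H g x) t = σ t g (Φ x t))
    (h411 : ∀ t, IsIrreducibleOrZero (σ t))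
    (hsep : ∀ s t : ι, Nontrivial (W s) →
      (∃ f : W s ≃ₗ[ℂ] W t, ∀ (g : G) (v : W s), f (σ s g v) = σ t g (f v)) → s = t) :
    IsSemisimpleModule (MonoidAlgebra ℂ G) H := by
  obtain ⟨C, -, hint, hs, -⟩ := exists_multiplicityFree_decomposition σ Φ hΦ h411 hsep
  refine isSemisimpleModule_of_isSemisimpleModule_submodule' (p := C) (fun t => ?_) hint.submodule_iSup_eq_top
  haveI := hs t
  infer_instance

/-- **M2a-E, ATOM form.**  Same as `exists_multiplicityFree_decomposition` with simplicity of the summands phrased in the LATTICE of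
`ℂ[G]`-submodules (`IsAtom (C t)`, Mathlib `isSimpleModule_iff_isAtom`) — the form consumable at carriers where `AddCommGroup ↥S`
does not synthesize (the model tower). [cite: Liu2021, Prop. 4.13, Def. 4.11, Thm. 4.18 (2), App. D Lem. D.1 (3)] -/
theorem exists_multiplicityFree_decomposition_atom (σ : ∀ t, Representation ℂ G (W t)) (Φ : H ≃ₗ[ℂ] ⨁ t, W t)
    (hΦ : ∀ (g : G) (x : H) (t : ι), Φ (Representation.ofModule' (k := ℂ) (G := G) H g x) t = σ t g (Φ x t))
    (h411 : ∀ t, IsIrreducibleOrZero (σ t))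
    (hsep : ∀ s t : ι, Nontrivial (W s) →
      (∃ f : W s ≃ₗ[ℂ] W t, ∀ (g : G) (v : W s), f (σ s g v) = σ t g (f v)) → s = t) :
    ∃ C : {t : ι // Nontrivial (W t)} → Submodule (MonoidAlgebra ℂ G) H,
      (∀ t, (C t).restrictScalars ℂ =
        (LinearMap.range (DirectSum.lof ℂ ι W t.1)).map (Φ.symm : (⨁ t, W t) →ₗ[ℂ] H)) ∧
      DirectSum.IsInternal C ∧
      (∀ t, IsAtom (C t)) ∧
      (∀ s t, Nonempty (C s ≃ₗ[MonoidAlgebra ℂ G] C t) → s = t) := by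
  obtain ⟨C, hC, hint, hs, hni⟩ := exists_multiplicityFree_decomposition σ Φ hΦ h411 hsep
  exact ⟨C, hC, hint, fun t => isSimpleModule_iff_isAtom.1 (hs t), hni⟩

/-- **MULTIPLICITY ONE OF `H` FROM THE END ROWS — the HEAD-A consumer interface verbatim** (nothj-p4's rows (i) `hss ∧ hmf`): under
[Liu2021, Prop. 4.13] (ℂ-linear equivariant `Φ`), [Liu2021, Def. 4.11] (`IsIrreducibleOrZero`) and the pairwise non-isomorphy of the
non-zero summands ([Liu2021, Thm. 4.18 (2)] ∕ [Liu2021, Lem. D.1 (3)]), the `ℂ[G]`-module `H` is SEMISIMPLE and ISOMORPHIC SIMPLE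
SUBMODULES COINCIDE (atoms of the submodule lattice; ✔ `NotHJ.multiplicityFree_of_iSupIndep_simple`).
[cite: Liu2021, Prop. 4.13 (FJcycle.tex ll. 2113–2119), Def. 4.11 (ll. 2083–2097), Thm. 4.18 (2) (l. 2240), App. D Lem. D.1 (3)] -/
theorem multOne_of_equivariant_directSum (σ : ∀ t, Representation ℂ G (W t)) (Φ : H ≃ₗ[ℂ] ⨁ t, W t)
    (hΦ : ∀ (g : G) (x : H) (t : ι), Φ (Representation.ofModule' (k := ℂ) (G := G) H g x) t = σ t g (Φ x t))
    (h411 : ∀ t, IsIrreducibleOrZero (σ t))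
    (hsep : ∀ s t : ι, Nontrivial (W s) →
      (∃ f : W s ≃ₗ[ℂ] W t, ∀ (g : G) (v : W s), f (σ s g v) = σ t g (f v)) → s = t) :
    IsSemisimpleModule (MonoidAlgebra ℂ G) H ∧
      ∀ S S' : Submodule (MonoidAlgebra ℂ G) H, IsAtom S → IsAtom S' →
        Nonempty (S ≃ₗ[MonoidAlgebra ℂ G] S') → S = S' := by
  obtain ⟨C, -, hint, hs, hni⟩ := exists_multiplicityFree_decomposition σ Φ hΦ h411 hsep
  refine ⟨isSemisimpleModule_of_equivariant_directSum σ Φ hΦ h411 hsep, fun S S' hS hS' e => ?_⟩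
  exact multiplicityFree_of_iSupIndep_simple C hs hni hint.submodule_iSupIndep hint.submodule_iSup_eq_top S S'
    (isSimpleModule_iff_isAtom.2 hS) (isSimpleModule_iff_isAtom.2 hS') e

end Rep

end Summit.HodgeConjecture.CorCM.D2Bridge.NotHJ

end
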